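import Mathlib
import HarnessLib
import Summits.AtomisticToContinuum.FouriersLaw.Theses.JunctionLocality
import Summits.AtomisticToContinuum.FouriersLaw.Theorems.JunctionLocalityConductanceLowerBoundAbelFloorFrequently

/-!
# `JunctionLocality.ConductanceLowerBound` — route-level split (strategist r1)

`ConductanceLowerBound ⟸ (A⁻⁻) OpenChainAbelFloorFrequently ∧ (R⁻) SignedSlowRegularity`,
concluding the **JunctionLocality** copy of the crux BY NAME.  The mathematics is the landed
Abel-floor exchange (p161612, `AbelFloorExchange.conductanceLowerBound_of_abelFloorFrequently_and_signedSlowRegularity`,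
stated at the definitionally equal `StaticAbelianSqueeze` copy): `ν₂ = ν₀(a/2)` from (R⁻), one
`ν ∈ (0, ν₂)` from (A⁻⁻), the Kubo identity `(N−1)T²D_N = ∫₀^∞ c_N` and the Abelian split at `ν`
give `D_N ≥ a/(2T²)` eventually.  This file is the glue of the route edit
`--split ConductanceLowerBound --into {OpenChainAbelFloorFrequently, SignedSlowRegularity}`.
-/

open scoped BigOperators Topology Manifold Classical MeasureTheory ProbabilityTheory Matrix InnerProductSpace ComplexConjugate ContinuousMap
open Filter Set Function TopologicalSpace MeasureTheory
open Literature.MathematicalPhysics.KineticTheory.HeatConduction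

namespace Summit.AtomisticToContinuum.FouriersLaw.Cruxes.ConductanceLowerBound.AbelFloorExchange

/-- **Split glue** `(A⁻⁻) → (R⁻) → JunctionLocality.ConductanceLowerBound`: the bulk half (an `N`-linear
Abel floor of the equilibrium open-chain current autocorrelation at some Laplace frequency below every
threshold) and the contact half (the `(1 - e^{-νt})`-weighted slow part of the Kubo integral is `≥ -εN`)
give the `N`-uniform Ohmic lower bound. [cite: KunduDharNarayan2009, p. 3] -/
theorem conductanceLowerBound_of_subs :
    (∀ ω₂ lam β γ : ℝ, 0 < ω₂ → 0 < lam → 0 < β → 0 < γ → ∀ T : ℝ, 0 < T →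
      ∃ a : ℝ, 0 < a ∧ ∀ ν₁ : ℝ, 0 < ν₁ → ∃ ν : ℝ, 0 < ν ∧ ν < ν₁ ∧ ∃ N₀ : ℕ, ∀ N : ℕ, N₀ ≤ N →
        a * N ≤ ∫ t in Set.Ioi (0:ℝ), Real.exp (-(ν * t)) *
          ∫ z, (∑ i : Fin N, (pinnedChain ω₂ lam β γ).bondCurrent N i z) *
            (∫ y, (∑ i : Fin N, (pinnedChain ω₂ lam β γ).bondCurrent N i y)
              ∂((pinnedChain ω₂ lam β γ).transitionKernel N T T t.toNNReal z))
            ∂((pinnedChain ω₂ lam β γ).gibbsMeasure N T)) →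
    (∀ ω₂ lam β γ : ℝ, 0 < ω₂ → 0 < lam → 0 < β → 0 < γ → ∀ T : ℝ, 0 < T →
      ∀ ε : ℝ, 0 < ε → ∃ ν₀ : ℝ, 0 < ν₀ ∧ ∀ ν : ℝ, 0 < ν → ν < ν₀ → ∃ N₀ : ℕ, ∀ N : ℕ, N₀ ≤ N →
        -(ε * N) ≤ ∫ t in Set.Ioi (0:ℝ), (1 - Real.exp (-(ν * t))) *
          ∫ z, (∑ i : Fin N, (pinnedChain ω₂ lam β γ).bondCurrent N i z) *
            (∫ y, (∑ i : Fin N, (pinnedChain ω₂ lam β γ).bondCurrent N i y)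
              ∂((pinnedChain ω₂ lam β γ).transitionKernel N T T t.toNNReal z))
            ∂((pinnedChain ω₂ lam β γ).gibbsMeasure N T)) →
    Summit.AtomisticToContinuum.FouriersLaw.Theses.JunctionLocality.ConductanceLowerBound :=
  fun hA hR => conductanceLowerBound_of_abelFloorFrequently_and_signedSlowRegularity hA hR

end Summit.AtomisticToContinuum.FouriersLaw.Cruxes.ConductanceLowerBound.AbelFloorExchange
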